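import Literature.AlgebraicGeometry.Resolution.MuPTorsorLocalUniformizationFFinite
import Literature.AlgebraicGeometry.Resolution.InseparableLocalUniformization
import Literature.AlgebraicGeometry.Resolution.SmoothImpliesRegular
import Mathlib.RingTheory.Smooth.Locus
import Mathlib.RingTheory.LocalProperties.Reduced
import HarnessLib

/-!
# Temkin's reduction to `μ_p`-torsors over an arbitrary ground field

**Source.** M. Temkin, *Inseparable local uniformization*, J. Algebra **373** (2013) 65–119,
arXiv:0804.1554 — Theorem 1.3.2 (inseparable local uniformization in its relative, smooth
form; in the tree as the named fact `Temkin2013Relative`) and Remark 1.3.5 (ii) (local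
uniformization would follow from uniformization of valuations on `μ_p`-torsors over regular
schemes; stated there under the hypothesis `[k : k^p] < ∞`, reproduced as printed in
`MuPTorsorLocalUniformizationFFinite`).

**What is proved here (claimed strengthening, kernel-checked modulo the named fact).** From
`Temkin2013Relative` we derive the conclusion of Remark 1.3.5 (ii) for an ARBITRARY ground field
`k` of characteristic `p` (`isLocallyUniformizable_of_muPTorsorStepsAt_of_relative`), hence
`LocalUniformizationInChar p ↔ MuPTorsorLocalUniformizationInChar p` given `Temkin2013Relative`
(`localUniformizationInChar_iff_muPTorsorInChar`). The source changes the ground field to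
`k^{1/p^n}`, which is finite over `k` only if `[k : k^p] < ∞`. Instead we base-change the
`l`-smooth model `N` of Theorem 1.3.2 (shrunk to a smooth basic open `N_g`) along the
`p^n`-power map `ψ : l → k`: `D = k ⊗_l N_g` is smooth and finitely presented over `k`, hence
regular (`isRegularLocalRing_of_isSmoothAt`) and reduced, and the natural map `D → K` is
injective because its kernel is nil — every `x ∈ D` has `x^{p^n} ∈ 1 ⊗ N_g` since
`k^{p^n} ⊆ ψ(l)` (`frobeniusTwist_injective`; no linear disjointness / separability of `k`
over `ψ(l)` is used). So `Φ(D) ⊆ O` is a finitely generated regular-at-the-centre model of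
`K₁ = Frac Φ(D) ⊇ L^{p^n}`, and `K = K₁(t₁, …, t_r)` with `tᵢ^{p^n} ∈ K₁` is a finite tower
of `μ_p`-torsors over the ground field `k` itself. We are not aware of this finiteness-free
form of Remark 1.3.5 (ii) in print; it is an elementary consequence of Theorem 1.3.2 and is
recorded as such.
-/

noncomputable section

open IsLocalRing TensorProduct

namespace Literature.AlgebraicGeometry.Resolution

universe u

/-! ## Frobenius twisting of a smooth algebra -/

/-- **Frobenius data of Temkin's theorem.** For finite purely inseparable extensions `L/K` and
`l/k` inside `L ⊇ K ⊇ k`, there are `n` and ring maps `φ : L → K`, `ψ : l → k`, both "raising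
to the `p^n`-th power", compatible with each other and with `k ⊆ K`. [folklore] -/
theorem exists_frobeniusData {p : ℕ} [hp : Fact p.Prime] {k K L : Type u} [Field k] [CharP k p]
    [Field K] [Algebra k K] [Field L] [Algebra K L] [Algebra k L] [IsScalarTower k K L]
    [FiniteDimensional K L] [IsPurelyInseparable K L] (l : IntermediateField k L)
    [FiniteDimensional k l] [IsPurelyInseparable k l] :
    ∃ (n : ℕ) (φ : L →+* K) (ψ : l →+* k), (∀ x : L, algebraMap K L (φ x) = x ^ p ^ n) ∧
      (∀ a : K, φ (algebraMap K L a) = a ^ p ^ n) ∧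
      (∀ c : l, algebraMap k K (ψ c) = φ (algebraMap l L c)) ∧
      (∀ d : k, ψ (algebraMap k l d) = d ^ p ^ n) := by
  haveI : CharP K p := charP_of_injective_algebraMap (algebraMap k K).injective p
  haveI : ExpChar K p := ExpChar.prime hp.out
  set n₁ : ℕ := IsPurelyInseparable.exponent K L
  set m : ℕ := IsPurelyInseparable.exponent k l
  let φ : L →+* K := IsPurelyInseparable.iterateFrobenius K L p (Nat.le_add_right n₁ m)
  have hφL : ∀ x : L, algebraMap K L (φ x) = x ^ p ^ (n₁ + m) := fun x =>
    IsPurelyInseparable.algebraMap_iterateFrobenius K p _ x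
  let ψ₀ : l →+* k := IsPurelyInseparable.iterateFrobenius k l p le_rfl
  have hψ₀ : ∀ c : l, algebraMap k l (ψ₀ c) = c ^ p ^ m := fun c =>
    IsPurelyInseparable.algebraMap_iterateFrobenius k p le_rfl c
  have hψ₀k : ∀ d : k, ψ₀ (algebraMap k l d) = d ^ p ^ m := fun d =>
    IsPurelyInseparable.iterateFrobenius_algebraMap l p le_rfl d
  refine ⟨n₁ + m, φ, (iterateFrobenius k p n₁).comp ψ₀, hφL,
    fun a => IsPurelyInseparable.iterateFrobenius_algebraMap L p _ a, fun c => ?_, fun d => ?_⟩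
  · apply (algebraMap K L).injective
    rw [hφL, ← IsScalarTower.algebraMap_apply, RingHom.comp_apply, iterateFrobenius_def, map_pow,
      IsScalarTower.algebraMap_apply k l L, hψ₀, map_pow, ← pow_mul, ← pow_add, add_comm]
  · rw [RingHom.comp_apply, hψ₀k, iterateFrobenius_def, ← pow_mul, ← pow_add, add_comm]

/-- **A smooth point has a smooth basic open neighbourhood** (openness of the smooth locus of a
finitely presented algebra). [folklore] -/
theorem exists_formallySmooth_away {l N : Type u} [Field l] [CommRing N] [Algebra l N]
    [Algebra.FiniteType l N] (𝔭 : Ideal N) [𝔭.IsPrime] (h : Algebra.IsSmoothAt l 𝔭) :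
    ∃ g : N, g ∉ 𝔭 ∧ Algebra.FormallySmooth l (Localization.Away g) := by
  haveI : Algebra.FinitePresentation l N := (Algebra.FinitePresentation.of_finiteType).mp ‹_›
  have hmem : (⟨𝔭, inferInstance⟩ : PrimeSpectrum N) ∈ Algebra.smoothLocus l N := h
  obtain ⟨_, ⟨g, rfl⟩, hg𝔭, hgsub⟩ :=
    PrimeSpectrum.isTopologicalBasis_basic_opens.exists_subset_of_mem_open hmem
      Algebra.isOpen_smoothLocus
  exact ⟨g, hg𝔭, Algebra.basicOpen_subset_smoothLocus_iff.mp hgsub⟩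

/-- **Frobenius twist: injectivity.** Let `k` be an `l`-algebra (both fields of characteristic
`p`) such that `k^{p^n}` lies in the image of `l`, let `M` be a formally smooth finitely
presented `l`-algebra and `χ : M → K` an injective `l`-algebra map to a field `K ⊇ k`. Then the
induced map `k ⊗_l M → K` is injective: its kernel consists of nilpotents (`x^{p^n} ∈ 1 ⊗ M` for
every `x`), and `k ⊗_l M`, being smooth over a field, is reduced (its local rings are regular).
[folklore] -/
theorem frobeniusTwist_injective {p : ℕ} [hp : Fact p.Prime] {l k M K : Type u} [Field l]
    [Field k] [Algebra l k] [CharP k p] [CommRing M] [Algebra l M] [Algebra.FormallySmooth l M]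
    [Algebra.FinitePresentation l M] [Field K] [Algebra k K] [Algebra l K] [IsScalarTower l k K]
    (n : ℕ) (hψ : ∀ c : k, ∃ c' : l, algebraMap l k c' = c ^ p ^ n) (χ : M →ₐ[l] K)
    (hχ : Function.Injective χ) :
    Function.Injective
      (Algebra.TensorProduct.lift (Algebra.ofId k K) χ fun _ _ => Commute.all _ _) := by
  set Φ := Algebra.TensorProduct.lift (Algebra.ofId k K) χ fun _ _ => Commute.all _ _
  haveI : Algebra.FinitePresentation k (k ⊗[l] M) := Algebra.FinitePresentation.baseChange k
  haveI : Nontrivial (k ⊗[l] M) := Φ.toRingHom.domain_nontrivial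
  haveI : CharP (k ⊗[l] M) p :=
    charP_of_injective_algebraMap (algebraMap k (k ⊗[l] M)).injective p
  -- smooth over a field ⟹ regular local rings ⟹ reduced
  haveI : IsReduced (k ⊗[l] M) := by
    refine isReduced_ofLocalizationMaximal (k ⊗[l] M) fun J hJ => ?_
    haveI := hJ
    haveI := isRegularLocalRing_of_isSmoothAt k (k ⊗[l] M) J
    haveI := isDomain_of_isRegularLocalRing (Localization.AtPrime J)
    infer_instance
  -- `x^{p^n} ∈ 1 ⊗ M`
  have key : ∀ x : k ⊗[l] M, ∃ y : M, x ^ p ^ n = 1 ⊗ₜ y := by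
    intro x
    induction x using TensorProduct.induction_on with
    | zero => exact ⟨0, by rw [tmul_zero, zero_pow (pow_ne_zero n hp.out.ne_zero)]⟩
    | tmul c y =>
      obtain ⟨c', hc'⟩ := hψ c
      refine ⟨c' • y ^ p ^ n, ?_⟩
      rw [Algebra.TensorProduct.tmul_pow, ← hc', Algebra.algebraMap_eq_smul_one, smul_tmul]
    | add x y hx hy =>
      obtain ⟨a, ha⟩ := hx
      obtain ⟨b, hb⟩ := hy
      exact ⟨a + b, by rw [add_pow_char_pow, ha, hb, tmul_add]⟩
  rw [injective_iff_map_eq_zero]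
  intro x hx
  obtain ⟨y, hy⟩ := key x
  have hy0 : χ y = 0 := by
    have h1 : Φ (x ^ p ^ n) = 0 := by rw [map_pow, hx, zero_pow (pow_ne_zero n hp.out.ne_zero)]
    rw [hy] at h1
    simpa [Φ, Algebra.TensorProduct.lift_tmul] using h1
  have hy' : y = 0 := (injective_iff_map_eq_zero χ).mp hχ y hy0
  rw [hy', tmul_zero] at hy
  exact IsReduced.eq_zero x ⟨p ^ n, hy⟩

open Literature.AlgebraicGeometry.CossartPiltant200819.CP2008 in
/-- **Frobenius twist: the model.** With `D` formally smooth and finitely presented over the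
field `k` and `Φ : D → K` an injective `k`-algebra map into a valued field `(K, O)` with
`Φ(D) ⊆ O`, the field of fractions `K₁ = Frac Φ(D) ⊆ K` is locally uniformizable at `O ∩ K₁`:
`Φ(D) ≅ D` is a finitely generated model, regular at the centre of `O` (smooth over a field
implies regular). [folklore] -/
theorem isLocallyUniformizable_adjoin_range_of_formallySmooth {k D K : Type u} [Field k]
    [CommRing D] [Algebra k D] [Algebra.FormallySmooth k D] [Algebra.FinitePresentation k D]
    [Field K] [Algebra k K] (Φ : D →ₐ[k] K) (hΦ : Function.Injective Φ)
    (O : ValuationSubring K) (hO : ∀ x, Φ x ∈ O) :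
    IsLocallyUniformizable k ↥(IntermediateField.adjoin k (Φ.range : Set K))
      (O.comap (algebraMap (IntermediateField.adjoin k (Φ.range : Set K)) K)) := by
  classical
  set B : Subalgebra k K := Φ.range with hB
  set K₁ := IntermediateField.adjoin k (B : Set K)
  have hBO : B.toSubring ≤ O.toSubring := by
    rintro x ⟨y, rfl⟩
    exact hO y
  let e : D ≃ₐ[k] B := AlgEquiv.ofInjective Φ hΦ
  have hBfg : B.FG :=
    (Subalgebra.fg_iff_finiteType B).mpr (Algebra.FiniteType.equiv inferInstance e)
  have hreg : IsRegularLocalRing (Localization.AtPrime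
      (Ideal.comap (Subring.inclusion hBO) (maximalIdeal O))) := by
    let e' : D ≃+* ↥B.toSubring := e.toRingEquiv.trans (subalgebraRingEquivToSubring B)
    rw [isRegularLocalRing_localization_iff_of_ringEquiv e']
    exact isRegularLocalRing_of_isSmoothAt k D _
  have hAK : ∀ x ∈ B, x ∈ Set.range (K₁.val : K₁ →ₐ[k] K) := fun x hx =>
    ⟨⟨x, IntermediateField.subset_adjoin k _ hx⟩, rfl⟩
  have hfrac : ∀ z : K₁, ∃ a b : K, a ∈ B ∧ b ∈ B ∧ b ≠ 0 ∧ (K₁.val : K₁ →ₐ[k] K) z = a / b := by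
    intro z
    obtain ⟨r, hr, s, hs, hz⟩ := IntermediateField.mem_adjoin_iff_div.mp z.2
    rw [Algebra.adjoin_eq] at hr hs
    by_cases hs0 : s = 0
    · refine ⟨0, 1, B.zero_mem, B.one_mem, one_ne_zero, ?_⟩
      rw [zero_div]
      show (z : K) = 0
      rw [hz, hs0, div_zero]
    · exact ⟨r, s, hr, hs, hs0, hz⟩
  exact isLocallyUniformizable_comap_of_model K₁.val O B hBO hAK hBfg hfrac hreg

/-- The image of `k ⊗_l M → K` lies in `O` as soon as `k` and the image of `M` do.
[folklore] -/
theorem tensorLift_mem {l k M K : Type u} [Field l] [Field k] [Algebra l k] [CommRing M]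
    [Algebra l M] [Field K] [Algebra k K] [Algebra l K] [IsScalarTower l k K] (χ : M →ₐ[l] K)
    (O : ValuationSubring K) (hk : ∀ c : k, algebraMap k K c ∈ O) (hχ : ∀ y, χ y ∈ O)
    (x : k ⊗[l] M) :
    Algebra.TensorProduct.lift (Algebra.ofId k K) χ (fun _ _ => Commute.all _ _) x ∈ O := by
  induction x using TensorProduct.induction_on with
  | zero => rw [map_zero]; exact O.zero_mem
  | tmul c y =>
    rw [Algebra.TensorProduct.lift_tmul]
    exact O.mul_mem _ _ (hk c) (hχ y)
  | add x y hx hy => rw [map_add]; exact O.add_mem _ _ hx hy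

/-- Extending an algebra map `f : N → K` (field `K`) with `f(g) ≠ 0` to `N_g`; the extension
is injective if `f` is, and its values are `f(x) · f(g)^{-i}`. [folklore] -/
theorem exists_algHom_away {l N K : Type u} [Field l] [CommRing N] [Algebra l N] [Field K]
    [Algebra l K] (f : N →ₐ[l] K) (g : N) (hg : f g ≠ 0) :
    ∃ χ : Localization.Away g →ₐ[l] K, (∀ x, χ (algebraMap N _ x) = f x) ∧
      (∀ z, ∃ (x : N) (i : ℕ), χ z = f x * ((f g)⁻¹) ^ i) ∧
      (Function.Injective f → Function.Injective χ) := by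
  have hunit : ∀ y : Submonoid.powers g, IsUnit (f y) := by
    rintro ⟨_, i, rfl⟩
    rw [map_pow]
    exact (isUnit_iff_ne_zero.mpr hg).pow i
  have h0 : ∀ x, IsLocalization.liftAlgHom (M := Submonoid.powers g) hunit
      (algebraMap N (Localization.Away g) x) = f x := fun x => by
    show (IsLocalization.liftAlgHom (M := Submonoid.powers g) hunit).toRingHom _ = _
    rw [IsLocalization.liftAlgHom_toRingHom, IsLocalization.lift_eq]
    rfl
  have hmk : ∀ (x : N) (i : ℕ), IsLocalization.liftAlgHom (M := Submonoid.powers g) hunit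
      (IsLocalization.mk' (Localization.Away g) x
        (⟨g ^ i, Submonoid.pow_mem _ (Submonoid.mem_powers g) i⟩ : Submonoid.powers g)) =
        f x * ((f g)⁻¹) ^ i := by
    intro x i
    rw [inv_pow, eq_mul_inv_iff_mul_eq₀ (pow_ne_zero i hg), ← map_pow, ← h0 (g ^ i), ← map_mul,
      ← h0 x]
    congr 1
    exact IsLocalization.mk'_spec (Localization.Away g) x
      (⟨g ^ i, Submonoid.pow_mem _ (Submonoid.mem_powers g) i⟩ : Submonoid.powers g)
  refine ⟨IsLocalization.liftAlgHom (M := Submonoid.powers g) hunit, h0, fun z => ?_,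
    fun hf => ?_⟩
  · obtain ⟨⟨x, _, i, rfl⟩, rfl⟩ := IsLocalization.mk'_surjective (Submonoid.powers g) z
    exact ⟨x, i, hmk x i⟩
  · rw [injective_iff_map_eq_zero]
    intro z hz
    obtain ⟨⟨x, _, i, rfl⟩, rfl⟩ := IsLocalization.mk'_surjective (Submonoid.powers g) z
    have h1 : f x * ((f g)⁻¹) ^ i = 0 := by rw [← hmk x i]; exact hz
    rw [mul_eq_zero, or_iff_left (pow_ne_zero i (inv_ne_zero hg)),
      map_eq_zero_iff f hf] at h1
    simp [h1]

/-! ## The main theorem -/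

set_option maxHeartbeats 400000 in
/-- **Reduction to `μ_p`-torsors over an arbitrary ground field.** Assume the relative (smooth)
form of Temkin's inseparable local uniformization. Let `k` be ANY field of characteristic `p`,
`K/k` finitely generated and `O` a valuation ring of `K/k` such that local uniformizability
climbs every `μ_p`-torsor `K₀ ⊂ K₀(a^{1/p})` inside `K` (`MuPTorsorStepsAt p k O`). Then `O` is
locally uniformizable over `k`.

Proof. Temkin gives `L ⊇ K` and `l ⊇ k` finite purely inseparable and a finitely generated
model `N ⊆ O_L` of `L/l`, smooth over `l` at the centre `𝔭`; shrink to a smooth basic open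
`N_g`. With `n` such that `L^{p^n} ⊆ K`, `l^{p^n} ⊆ k`, the `p^n`-th power maps
`φ : L → K`, `ψ : l → k` make `k` an `l`-algebra and `χ = φ|_{N_g} : N_g → K` an `l`-map, so
`Φ : D = k ⊗_l N_g → K` is defined; `D` is smooth and finitely presented over `k`, `Φ` is
injective (`frobeniusTwist_injective`: no linear-disjointness is needed, because `k^{p^n} ⊆ ψ(l)`
forces `ker Φ` to be nil and `D` is reduced), so `B = Φ(D) ⊆ O` is a finitely generated
`k`-model of `K₁ = Frac B ∋ φ(L)`, regular at the centre of `O`: `O ∩ K₁` is uniformizable over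
`k`. Finally `K = K₁(t₁, …, t_r)` with `tᵢ^{p^n} = φ(tᵢ) ∈ K₁`: a finite tower of `μ_p`-torsors
over the ground field `k`, climbed by the hypothesis. This removes the assumption
`[k : k^p] < ∞` of [Temkin2013, Rem. 1.3.5 (ii)] (there the ground field changes to `k^{1/p^n}`;
here the smooth `l`-model of Theorem 1.3.2 is base-changed along `ψ` instead).
[cite: Temkin2013, Thm. 1.3.2 and Rem. 1.3.5 (ii)] -/
theorem isLocallyUniformizable_of_muPTorsorStepsAt_of_relative {p : ℕ} [hp : Fact p.Prime]
    (hT : Temkin2013Relative.{u}) {k K : Type u} [Field k] [CharP k p] [Field K] [Algebra k K]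
    (hfg : (⊤ : IntermediateField k K).FG) (O : ValuationSubring K)
    (hk : ∀ c : k, algebraMap k K c ∈ O) (H : MuPTorsorStepsAt p k O) :
    IsLocallyUniformizable k K O := by
  classical
  obtain ⟨A, hAO, hAfg, hAfr⟩ := exists_affineModel k K hfg O hk
  obtain ⟨L, _, _, _, _, hfin, hpi, l, hlfin, hlpi, A', -, -, -, -, O', hO', N, hN, -, hNfg, hNfr,
    hsm, -, -⟩ := hT k K hfg O hk A hAO hAfg hAfr
  haveI := hfin
  haveI := hpi
  haveI := hlfin
  haveI := hlpi
  obtain ⟨n, φ, ψ, hφL, hφK, hψ, hψk⟩ := exists_frobeniusData (p := p) (k := k) (K := K) l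
  have hφO : ∀ x : L, x ∈ O' → φ x ∈ O := by
    intro x hx
    rw [← hO', ValuationSubring.mem_comap, hφL]
    exact pow_mem hx _
  -- `k` and `K` as `l`-algebras through `ψ`
  letI : Algebra l k := ψ.toAlgebra
  letI : Algebra l K := ((algebraMap k K).comp ψ).toAlgebra
  haveI : IsScalarTower l k K := IsScalarTower.of_algebraMap_eq fun _ => rfl
  -- a smooth neighbourhood `N_g` of the centre of `O'` on `N`
  haveI : Algebra.FiniteType k N := (Subalgebra.fg_iff_finiteType _).mp hNfg
  haveI : Algebra.FiniteType l N := Algebra.FiniteType.of_restrictScalars_finiteType k l N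
  obtain ⟨g, hg, hNg⟩ := exists_formallySmooth_away (centreIdeal N O' hN) hsm
  haveI := hNg
  haveI : Algebra.FinitePresentation l N := (Algebra.FinitePresentation.of_finiteType).mp ‹_›
  haveI : Algebra.FinitePresentation N (Localization.Away g) :=
    IsLocalization.Away.finitePresentation g
  haveI : Algebra.FinitePresentation l (Localization.Away g) :=
    Algebra.FinitePresentation.trans l N (Localization.Away g)
  have hg0 : (g : L) ≠ 0 := fun h0 => by
    apply hg
    have : g = 0 := Subtype.ext h0
    rw [this]
    exact (centreIdeal N O' hN).zero_mem
  -- `g⁻¹ ∈ O'`, hence `φ(g)⁻¹ ∈ O`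
  have hginv : ((g : L))⁻¹ ∈ O' := by
    have hgu : IsUnit (⟨(g : L), hN g.2⟩ : O') := by
      by_contra hnu
      exact hg ((IsLocalRing.mem_maximalIdeal _).mpr hnu)
    obtain ⟨u, hu⟩ := hgu
    have h1 : ((u⁻¹ : (O')ˣ) : O') * ⟨(g : L), hN g.2⟩ = 1 := by rw [← hu, Units.inv_mul]
    have h2 : (((u⁻¹ : (O')ˣ) : O') : L) * (g : L) = 1 := by
      have := congrArg (fun z : O' => (z : L)) h1
      simpa using this
    rw [inv_eq_of_mul_eq_one_left h2]
    exact SetLike.coe_mem _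
  have hφginv : (φ g)⁻¹ ∈ O := by
    rw [← map_inv₀]
    exact hφO _ hginv
  -- `χ = φ` on `N_g`, an injective `l`-algebra map to `O ⊆ K`
  obtain ⟨φN, hφN⟩ : ∃ φN : N →ₐ[l] K, ∀ x : N, φN x = φ x :=
    ⟨{ φ.comp (N.val : N →+* L) with commutes' := fun c => (hψ c).symm }, fun _ => rfl⟩
  have hφNg : φN g ≠ 0 := by
    rw [hφN, map_ne_zero φ]
    exact hg0
  obtain ⟨χ, hχN, hχz, hχinj⟩ := exists_algHom_away φN g hφNg
  replace hχinj : Function.Injective χ :=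
    hχinj fun x y hxy => Subtype.ext (φ.injective (by rw [← hφN, ← hφN, hxy]))
  have hχO : ∀ z, χ z ∈ O := by
    intro z
    obtain ⟨x, i, hz⟩ := hχz z
    rw [hz, hφN, hφN]
    exact O.mul_mem _ _ (hφO _ (hN x.2)) (pow_mem hφginv i)
  -- the twisted model `Φ : D = k ⊗_l N_g → K`
  haveI : Algebra.FinitePresentation k (k ⊗[l] Localization.Away g) :=
    Algebra.FinitePresentation.baseChange k
  have hψ' : ∀ c : k, ∃ c' : l, algebraMap l k c' = c ^ p ^ n := fun c =>
    ⟨algebraMap k l c, hψk c⟩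
  have hΦinj := frobeniusTwist_injective (K := K) n hψ' χ hχinj
  have hLU₁ := isLocallyUniformizable_adjoin_range_of_formallySmooth _ hΦinj O
    (tensorLift_mem χ O hk hχO)
  -- `K = K₁(t)` with `tᵢ^{p^n} ∈ φ(L) ⊆ K₁ = Frac Φ(D)`: a finite `μ_p`-torsor tower over `k`
  set K₁ := IntermediateField.adjoin k
    ((Algebra.TensorProduct.lift (Algebra.ofId k K) χ fun _ _ => Commute.all _ _).range : Set K)
    with hK₁
  have hφa : ∀ a : N, φ a ∈ K₁ := fun a => by
    have h1 : (Algebra.TensorProduct.lift (Algebra.ofId k K) χ fun _ _ => Commute.all _ _)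
        (1 ⊗ₜ algebraMap N (Localization.Away g) a) = φ a := by
      rw [Algebra.TensorProduct.lift_tmul, map_one, one_mul, hχN, hφN]
    rw [← h1]
    exact IntermediateField.subset_adjoin k _ (AlgHom.mem_range_self _ _)
  have hφx : ∀ x : L, φ x ∈ K₁ := by
    intro x
    obtain ⟨a, b, -, hab⟩ := IsFractionRing.div_surjective (A := N) x
    rw [← hab, map_div₀]
    exact div_mem (hφa a) (hφa b)
  obtain ⟨t, ht⟩ := hfg
  have ht' : ∀ x ∈ t, x ^ p ^ n ∈ K₁ := fun x _ => by
    rw [← hφK]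
    exact hφx _
  have htop := muPTorsor_tower_at O H K₁ n t ht' hLU₁
  have hsup : K₁ ⊔ IntermediateField.adjoin k (t : Set K) = ⊤ := by
    rw [ht]
    exact sup_top_eq _
  rw [hsup] at htop
  -- from `⊤ ≤ K` to `K`
  let e' : (⊤ : IntermediateField k K) ≃+* K :=
    (IntermediateField.topEquiv (F := k) (E := K)).toRingEquiv
  have hcomap : O.comap (e' : (⊤ : IntermediateField k K) →+* K) =
      O.comap (algebraMap (⊤ : IntermediateField k K) K) := by
    ext x; rfl
  refine IsLocallyUniformizable.of_ringEquiv e' (RingEquiv.refl k) (fun c => ?_) O ?_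
  · exact (IntermediateField.topEquiv (F := k) (E := K)).commutes c
  · rw [hcomap]
    exact htop

/-! ## Global statements -/

/-- **`μ_p`-torsor uniformization implies local uniformization, over every ground field of
characteristic `p`** (given Temkin's relative theorem).
[cite: Temkin2013, Thm. 1.3.2 and Rem. 1.3.5 (ii)] -/
theorem MuPTorsorLocalUniformizationInChar.localUniformizationInChar {p : ℕ} [Fact p.Prime]
    (hT : Temkin2013Relative.{u}) (H : MuPTorsorLocalUniformizationInChar.{u} p) :
    LocalUniformizationInChar.{u} p :=
  fun k K _ _ _ _ hfg O hk =>
    isLocallyUniformizable_of_muPTorsorStepsAt_of_relative hT hfg O hk (H k K O)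

/-- **Local uniformization in characteristic `p` ⟺ uniformization of `μ_p`-torsors**, for all
ground fields at once, given Temkin's relative theorem.
[cite: Temkin2013, Thm. 1.3.2 and Rem. 1.3.5 (ii)] -/
theorem localUniformizationInChar_iff_muPTorsorInChar {p : ℕ} [Fact p.Prime]
    (hT : Temkin2013Relative.{u}) :
    LocalUniformizationInChar.{u} p ↔ MuPTorsorLocalUniformizationInChar.{u} p :=
  ⟨LocalUniformizationInChar.muPTorsorInChar, fun H => H.localUniformizationInChar hT⟩

/-- In particular the F-finite statement `LocalUniformizationFFiniteInChar p` already follows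
from `μ_p`-torsor uniformization over F-finite fields together with Temkin's relative theorem
(cf. `MuPTorsorLocalUniformizationFFinite.localUniformizationFFinite`, which uses the weak
form `Temkin2013` and the ground field `k^{p^n}`). [folklore] -/
theorem localUniformizationFFiniteInChar_of_relative_of_muPTorsorInChar {p : ℕ} [Fact p.Prime]
    (hT : Temkin2013Relative.{u}) (H : MuPTorsorLocalUniformizationInChar.{u} p) :
    LocalUniformizationFFiniteInChar.{u} p :=
  (H.localUniformizationInChar hT).ffinite

end Literature.AlgebraicGeometry.Resolution

end
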